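import Summits.QuantumFields.BalabanUV.Beta.AliasCharacters
import Summits.QuantumFields.BalabanUV.Beta.SaddleInverseContract
import Summits.QuantumFields.BalabanUV.Beta.GAN24.AliasObjects

/-!
# Beta / SaddleInverseInstance — the ALIAS INSTANCE of the kernel-pairing package: twisted alias characters × `GAN24/AliasObjects` symbols;
# every structural hypothesis of `Beta/SaddleInverseContract.norm_inv_saddle_aOp_le` DISCHARGED BY NAME, leaving exactly the residual bound
# (β sub-cell, CAP lane «KERNEL ALGEBRA + EXPORT», lineage `b2b-balaban-beta-cap3`, gen 10 → 11; DEFINITIONAL — no estimate, no number)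

WHY.  `Beta/SaddleInverseModes` ∕ `Beta/SaddleInverseContract` hold for ANY biorthogonal complete family `(E_t, F_t)` and per-mode data with
`∂♭_t · ∂_t = L_t`, `c_t L_t = 1`.  This leaf PLUGS IN the cell's data (CAP-KERNEL §4.15 ∕ §4.18): modes `t : TorusSite D N` (the `N^D`
aliases of one block), `E_t := Mi · charE t`, `F_t := charF t · M` — the alias characters of `Beta/AliasCharacters` twisted by an
arbitrary similarity `M`, `Mi` with `M Mi = 1 = Mi M` (in the cell: the diagonal quasi-momentum phase; WHICH diagonal is the engine's
dictionary, not fixed here), and `∂_t, ∂♭_t, L_t := GAN24/AliasObjects.dAl ∕ dbAl ∕ LAl N q t` at coarse momentum `q : Fin D → ℂ`, with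
`c_t := (LAl N q t)⁻¹` on the regular zone `∀ t, LAl N q t ≠ 0`.  Then biorthogonality is `AliasCharacters.biorth_char` transported by
`ModeSum.Biorth.similar`, completeness is `AliasCharacters.sum_charE_mul_charF` conjugated, `∂♭·∂ = L` is `AliasObjects.dot_dbAl_dAl`,
and `c L = 1` is `inv_mul_cancel₀` — so the kernel ∕ cokernel ∕ defect identities and the engine contract hold for the block
`blockA M Mi q := aOp (twE Mi) (twF M) (dAl N q) (dbAl N q) (LAl N q)` with NO hypothesis left except `M Mi = 1`, `Mi M = 1`, regularity of
`q`, and — in the norm statement — the residual bound `‖𝓔‖ ≤ ½`, which is the certificate engine's ONLY job.  [folklore] wiring; nothing re-proved.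

## What is proved (`D N : ℕ`, `[NeZero N]`; `M Mi : Matrix (TorusSite D N × Fin D) (TorusSite D N × Fin D) ℂ`; `q : Fin D → ℂ`)
* §1 `twE`, `twF` (twisted characters); `biorth_tw : M * Mi = 1 → Biorth (twE Mi) (twF M)`; `complete_tw : Mi * M = 1 → Σ_t twE Mi t * twF M t = 1`.
* §2 `cAl N q t := (LAl N q t)⁻¹`; `cAl_mul_LAl : LAl N q t ≠ 0 → cAl N q t * LAl N q t = 1` (`∂♭_t · ∂_t = L_t` is `GAN24/AliasObjects.dot_dbAl_dAl` BY NAME —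
  `FibreBlockSolve.dot` is Mathlib's `dotProduct` by `rfl`, cf. `AliasBlock.dot_eq_dotProduct`).
* §3 `blockA`, `blockG`, `blockKer`, `blockCoker`, `blockY` (the instance of `aOp`, `gOp`, `kerFrame`, `cokerFrame`, `yFrame`);
  **`blockA_mul_blockKer = 0`**, **`blockCoker_mul_blockA = 0`**, **`blockA_mul_blockG : blockA * blockG = 1 − blockY * blockCoker`** (regular `q`);
  §4 **`norm_inv_saddle_blockA_le`**: for ANY `B♭`, `B`, `Vi`, `Wi`,
  `‖pairingResidual …‖ ≤ ½ ⇒ IsUnit (saddle blockA B♭ B).det ∧ ‖(saddle blockA B♭ B)⁻¹‖ ≤ 2‖pairingInv …‖`,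
  and `saddle_blockA_mul_pairingInv_eq_one_add` (`saddle blockA B♭ B · pairingInv = 1 + pairingResidual` for any `B♭`, `B`, `Vi`, `Wi`; everything over `ℂ`).

HONEST FRAMING.  Definitional wiring of landed leaves, [folklore]; the identification of `blockA` (for the right diagonal `M`) with the
quadratic form of one Hessian block of the cell, and of `saddle blockA B♭ B` (for the right `B`) with the tree-pinned `K_big` of
`Beta/SaddleInverse` §3, is the engine's DICTIONARY (CAP-KERNEL §4.15), NOT proved here.  This module proves NO bound on any object of the
cell, NO number of the β-function, NO statement about Bałaban's operators, and discharges NOTHING of `FlowStep.BetaPertH`.  Discharging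
`BetaPertH` would make Bałaban's ultraviolet stability unconditional — NOT the continuum limit and NOT the Clay problem.  0 `sorry`, 0 cite tags.
-/

namespace Summit.QuantumFields.BalabanUV.Beta.SaddleInverseInstance

open Matrix
open Literature.Probability.LatticeModels (TorusSite)
open ModeSum (Biorth)
open AliasCharacters (charE charF biorth_char sum_charE_mul_charF)
open GAN24.AliasObjects (dAl dbAl LAl dot_dbAl_dAl)
open SaddleInverse (saddle pairingInv pairingResidual)
open SaddleInverseModes (aOp gOp kerFrame cokerFrame yFrame aOp_mul_kerFrame cokerFrame_mul_aOp aOp_mul_gOp)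

variable {D N : ℕ} [NeZero N]

/-! ## §1 Twisted alias characters -/

/-- The twisted alias characters `E_t = Mi · charE t`. -/
noncomputable def twE (Mi : Matrix (TorusSite D N × Fin D) (TorusSite D N × Fin D) ℂ) (t : TorusSite D N) :
    Matrix (TorusSite D N × Fin D) (Fin D) ℂ :=
  Mi * charE t

/-- The twisted dual characters `F_t = charF t · M`. -/
noncomputable def twF (M : Matrix (TorusSite D N × Fin D) (TorusSite D N × Fin D) ℂ) (t : TorusSite D N) :
    Matrix (Fin D) (TorusSite D N × Fin D) ℂ :=
  charF t * M

variable {M Mi : Matrix (TorusSite D N × Fin D) (TorusSite D N × Fin D) ℂ}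

/-- [folklore] Biorthogonality survives the twist (`AliasCharacters.biorth_char` + `ModeSum.Biorth.similar`). -/
theorem biorth_tw (hM : M * Mi = 1) : Biorth (twE Mi) (twF M) :=
  biorth_char.similar hM

/-- [folklore] Completeness survives the twist: `Σ_t (Mi charE t)(charF t M) = Mi (Σ_t charE t charF t) M = 1`. -/
theorem complete_tw (hMi : Mi * M = 1) : ∑ t, twE Mi t * twF M t = 1 := by
  have e : ∀ t, twE Mi t * twF M t = Mi * (charE t * charF t * M) := fun t => by
    simp only [twE, twF, Matrix.mul_assoc]
  simp_rw [e, ← Finset.mul_sum, ← Finset.sum_mul, sum_charE_mul_charF, Matrix.one_mul, hMi]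

/-! ## §2 Per-mode alias data at coarse momentum `q` -/

/-- `c_t := (L_t)⁻¹`, the inverse Laplacian symbol of alias `t` (meaningful on the regular zone `L_t ≠ 0`). -/
noncomputable def cAl (N : ℕ) [NeZero N] (q : Fin D → ℂ) (t : TorusSite D N) : ℂ := (LAl N q t)⁻¹

/-- [folklore] `c_t L_t = 1` on the regular zone. -/
theorem cAl_mul_LAl {q : Fin D → ℂ} {t : TorusSite D N} (h : LAl N q t ≠ 0) : cAl N q t * LAl N q t = 1 :=
  inv_mul_cancel₀ h

/-! ## §3 The block instance and its kernel ∕ cokernel ∕ defect identities -/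

/-- The mode-diagonal block `A(q) = Σ_t E_t N_t(q) F_t` of the alias instance. -/
noncomputable def blockA (M Mi : Matrix (TorusSite D N × Fin D) (TorusSite D N × Fin D) ℂ) (q : Fin D → ℂ) :
    Matrix (TorusSite D N × Fin D) (TorusSite D N × Fin D) ℂ :=
  aOp (twE Mi) (twF M) (dAl N q) (dbAl N q) (LAl N q)

/-- Its explicit group inverse `G(q) = Σ_t E_t (c_t² N_t) F_t`. -/
noncomputable def blockG (M Mi : Matrix (TorusSite D N × Fin D) (TorusSite D N × Fin D) ℂ) (q : Fin D → ℂ) :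
    Matrix (TorusSite D N × Fin D) (TorusSite D N × Fin D) ℂ :=
  gOp (twE Mi) (twF M) (dAl N q) (dbAl N q) (LAl N q) (cAl N q)

/-- Its kernel frame (column `t` = the pure-gauge mode `E_t ∂_t`). -/
noncomputable def blockKer (Mi : Matrix (TorusSite D N × Fin D) (TorusSite D N × Fin D) ℂ) (q : Fin D → ℂ) :
    Matrix (TorusSite D N × Fin D) (TorusSite D N) ℂ :=
  kerFrame (twE Mi) (dAl N q)

/-- Its cokernel frame (row `t` = `∂♭_tᵀ F_t`). -/
noncomputable def blockCoker (M : Matrix (TorusSite D N × Fin D) (TorusSite D N × Fin D) ℂ) (q : Fin D → ℂ) :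
    Matrix (TorusSite D N) (TorusSite D N × Fin D) ℂ :=
  cokerFrame (twF M) (dbAl N q)

/-- Its scaled kernel frame `Y` (column `t` = `E_t (c_t ∂_t)`). -/
noncomputable def blockY (Mi : Matrix (TorusSite D N × Fin D) (TorusSite D N × Fin D) ℂ) (q : Fin D → ℂ) :
    Matrix (TorusSite D N × Fin D) (TorusSite D N) ℂ :=
  yFrame (twE Mi) (dAl N q) (cAl N q)

/-- [folklore] `A(q) · kerFrame = 0` — hypothesis `hAN` of `Beta/SaddleInverse`, discharged for the alias instance. -/
theorem blockA_mul_blockKer (hM : M * Mi = 1) (q : Fin D → ℂ) : blockA M Mi q * blockKer Mi q = 0 :=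
  aOp_mul_kerFrame (biorth_tw hM) (fun t => dot_dbAl_dAl N q t)

/-- [folklore] `cokerFrame · A(q) = 0`. -/
theorem blockCoker_mul_blockA (hM : M * Mi = 1) (q : Fin D → ℂ) : blockCoker M q * blockA M Mi q = 0 :=
  cokerFrame_mul_aOp (biorth_tw hM) (fun t => dot_dbAl_dAl N q t)

/-- [folklore] THE DEFECT `A(q) G(q) = 1 − Y(q) · cokerFrame(q)` on the regular zone — hypothesis `hAG` of `Beta/SaddleInverse`, discharged. -/
theorem blockA_mul_blockG (hM : M * Mi = 1) (hMi : Mi * M = 1) {q : Fin D → ℂ} (hreg : ∀ t : TorusSite D N, LAl N q t ≠ 0) :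
    blockA M Mi q * blockG M Mi q = 1 - blockY Mi q * blockCoker M q :=
  aOp_mul_gOp (biorth_tw hM) (complete_tw hMi) (fun t => dot_dbAl_dAl N q t) fun t => cAl_mul_LAl (hreg t)

/-! ## §4 The engine contract for the alias instance -/

section Contract

open scoped Matrix.Norms.L2Operator

variable {m : Type*} [Fintype m] [DecidableEq m]

/-- [folklore] `saddle(A(q), B♭, B) · pairingInv = 1 + 𝓔` for ANY `B♭`, `B`, `Vi`, `Wi` (regular `q`). -/
theorem saddle_blockA_mul_pairingInv_eq_one_add (hM : M * Mi = 1) (hMi : Mi * M = 1) {q : Fin D → ℂ}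
    (hreg : ∀ t : TorusSite D N, LAl N q t ≠ 0) (Bf : Matrix (TorusSite D N × Fin D) m ℂ) (B : Matrix m (TorusSite D N × Fin D) ℂ)
    (Vi : Matrix (TorusSite D N) m ℂ) (Wi : Matrix m (TorusSite D N) ℂ) :
    saddle (blockA M Mi q) Bf B * pairingInv Bf B (blockG M Mi q) (blockKer Mi q) (blockCoker M q) Vi Wi =
      1 + pairingResidual Bf B (blockG M Mi q) (blockKer Mi q) (blockCoker M q) (blockY Mi q) Vi Wi :=
  SaddleInverseContract.saddle_aOp_mul_pairingInv_eq_one_add (biorth_tw hM) (complete_tw hMi) (fun t => dot_dbAl_dAl N q t)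
    (fun t => cAl_mul_LAl (hreg t)) Bf B Vi Wi

/-- [folklore] THE ENGINE CONTRACT FOR THE ALIAS INSTANCE: on the regular zone, for ANY constraint matrices `B♭`, `B` and ANY approximate
Faddeev–Popov inverses `Vi`, `Wi`, the residual bound `‖𝓔‖ ≤ ½` (Euclidean operator norm; an INPUT, certified by nobody here) gives
`IsUnit (saddle A(q) B♭ B).det ∧ ‖(saddle A(q) B♭ B)⁻¹‖ ≤ 2 ‖pairingInv‖`. -/
theorem norm_inv_saddle_blockA_le (hM : M * Mi = 1) (hMi : Mi * M = 1) {q : Fin D → ℂ}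
    (hreg : ∀ t : TorusSite D N, LAl N q t ≠ 0) (Bf : Matrix (TorusSite D N × Fin D) m ℂ) (B : Matrix m (TorusSite D N × Fin D) ℂ)
    (Vi : Matrix (TorusSite D N) m ℂ) (Wi : Matrix m (TorusSite D N) ℂ)
    (hE : ‖pairingResidual Bf B (blockG M Mi q) (blockKer Mi q) (blockCoker M q) (blockY Mi q) Vi Wi‖ ≤ 1 / 2) :
    IsUnit (saddle (blockA M Mi q) Bf B).det ∧
      ‖(saddle (blockA M Mi q) Bf B)⁻¹‖ ≤ 2 * ‖pairingInv Bf B (blockG M Mi q) (blockKer Mi q) (blockCoker M q) Vi Wi‖ :=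
  SaddleInverseContract.norm_inv_saddle_aOp_le (biorth_tw hM) (complete_tw hMi) (fun t => dot_dbAl_dAl N q t)
    (fun t => cAl_mul_LAl (hreg t)) Bf B Vi Wi hE

end Contract

end Summit.QuantumFields.BalabanUV.Beta.SaddleInverseInstance
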